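import Summits.ResolutionOfSingularities.ResolutionOfSingularities.Theorems.FrobeniusClosingSteerRadicandChainNoExcFactor
import Literature.AlgebraicGeometry.Resolution.RegularLocalRingsNormal
import HarnessLib

/-!
# Crux `Steer` (stmt-ResolutionOfSingularities-16345), chain W4.1, p = 2 T-line, frontier piece F-A3(3):
# PARITY OF THE STRIPPING EXPONENT in an isolated stripped radicand chain (`NoEternalStrippedRadicandChain p c`, c ≥ 3)

OURS (campaign `res-hironaka`, rung L ★L-G4, slot W4.1; seat res-L0-w41-stub-2 g5, object W4.1 U8 «G(3) point-and-strip
census» of res-L0-w41-plan-1 UNCLAIMED-STUB LIST v2 2026-08-27T09:22:05Z; replaces the role of no printed item; NOT a statement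
of the manuscript under review; AI-produced, weaker than expert review). These are the by-hand reductions behind the census
engine `L/res-L0-w41-stub-2/g3census/`, in kernel form, over the VERBATIM binders of the K♭(c) Prop
`NoEternalStrippedRadicandChain` (Steer skeleton r31 §σ2.25): law `f (m+1) · (x m)^(p·e m) = f m − (g m)^p`, multiplicity `p`
after cleaning and ISOLATED radicand singularity at every member.

* `RadicandChain.false_of_sub_pow_eq_mul_of_isolated` — **(B3)** (generalises (B2) of
  `FrobeniusClosingSteerRadicandChainNoExcFactor.lean` from `h = 0` to an arbitrary cleaner): in a regular local domain of
  dimension `c ≥ 3`, a radicand with `f₁ − h^p = x·y`, `x, y ∈ 𝔪`, never has an isolated radicand singularity — a minimal prime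
  `𝔮 ⊇ (x, y)` has height `≤ 2 < c` and `f₁ − h^p ∈ 𝔮²` contradicts (B1);
* `RadicandChain.false_of_sub_pow_eq_sq_mul_of_isolated` — **(B4)** the same for `f₁ − h^p = x²·A`, `x ∈ 𝔪`, dimension `c ≥ 2`
  (a minimal prime over `(x)` has height `≤ 1`): UNDER-STRIPPING IS IMPOSSIBLE;
* `RadicandChain.cleaner_sub_pow_not_mem_pow_succ` — **PARITY LAW for the chain**: under the binders of
  `NoEternalStrippedRadicandChain p c` (`c ≥ 3`; with the exceptional parameters assumed regular parameters of the next member,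
  `x m ∉ 𝔪_{m+1}²`, as in (B2′)), NO cleaner does better than the stripping exponent: `f m − h^p ∉ 𝔪_m^(p·e m + 1)` for every
  `m` and every `h`. So the cleaned order of the member `f m` is at most `p · e m` (and the law gives `≥ p · e m` whenever
  `𝔪_m^k` is contracted from `S (m+1)`): at `p = 2` every member of a stripped chain has EVEN cleaned order `2 · e m` — odd
  cleaned orders are terminal, and the exponent `e m` is forced. Proof: if `f m − h^p ∈ 𝔪_m^(pe+1) = (x m)^(pe+1) S(m+1)` then
  `(h − g m)^p = (x m)^(pe) · (f (m+1) − x m · A)`, so `x m ^ e ∣ h − g m` (regular ⇒ integrally closed,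
  `IsIntegrallyClosed.pow_dvd_pow_iff`) and `f (m+1) − h'^p = x m · A`; `A ∈ 𝔪` is (B3), `A` a unit contradicts multiplicity `p`
  at stage `m+1` with `x m ∉ 𝔪²`.

Census use (memo `L/res-L0-w41-stub-2/G3-CENSUS.md` §1): with (B2′)/low-order-absorption these say that an ETERNAL stripped chain
at `p = 2` lives in the species {cleaned order `2e ≥ 4` even, isolated}, which is what the engine enumerates.

[cite: Matsumura1987, Thm. 13.5, Thm. 14.2 and Thm. 19.4] [cite: Cutkosky2014, §2.1] [folklore]
-/

noncomputable section

-- `Summit.<S>.<S>.…` duplicates the summit name by design (single-problem summit).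
set_option linter.dupNamespace false

open Polynomial IsLocalRing

namespace Summit.ResolutionOfSingularities.ResolutionOfSingularities.Theorems.SwitchingDichotomy

namespace RadicandChain

universe u

/-! ## (B3), (B4): single member -/

section SingleMember

variable (p : ℕ) [hp : Fact p.Prime] {S₁ : Type u} [CommRing S₁] [IsDomain S₁] [IsRegularLocalRing S₁] [CharP S₁ p]

/-- **(B3).** In a regular local domain `S₁` of characteristic `p` and dimension `c ≥ 3`, if `f₁ − h^p = x · y` with
`x, y ∈ 𝔪`, then the radicand ring `S₁[X]/(X^p − f₁)` violates the isolatedness binder: a minimal prime `𝔮 ⊇ (x, y)` has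
height `≤ 2 < c` (Krull), is not maximal, and `f₁ − h^p ∈ 𝔮²` contradicts (B1)
(`sub_pow_not_mem_sq_of_isolated`). [cite: Matsumura1987, Thm. 13.5 and Thm. 14.2] [folklore] -/
theorem false_of_sub_pow_eq_mul_of_isolated (c : ℕ) (hc : 3 ≤ c) (hdim : ringKrullDim S₁ = c) (f₁ h x y : S₁)
    (hx : x ∈ maximalIdeal S₁) (hy : y ∈ maximalIdeal S₁) (he : f₁ - h ^ p = x * y)
    (hisol : ∀ (Q : Ideal (AdjoinRoot ((X : S₁[X]) ^ p - C f₁))) [Q.IsPrime],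
      (∃ Q' : Ideal (AdjoinRoot ((X : S₁[X]) ^ p - C f₁)), Q'.IsPrime ∧ Q < Q') →
      IsRegularLocalRing (Localization.AtPrime Q)) : False := by
  classical
  haveI : IsRegularRing S₁ := Literature.AlgebraicGeometry.Resolution.isRegularRing_of_isRegularLocalRing S₁
  set I : Ideal S₁ := Ideal.span {x, y} with hI
  have hIm : I ≤ maximalIdeal S₁ := by
    rw [hI, Ideal.span_le]
    rintro z (rfl | rfl)
    · exact hx
    · exact hy
  obtain ⟨𝔮, h𝔮min, -⟩ := Ideal.exists_minimalPrimes_le hIm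
  haveI h𝔮p : 𝔮.IsPrime := h𝔮min.1.1
  have hI𝔮 : I ≤ 𝔮 := h𝔮min.1.2
  have hht : 𝔮.height ≤ 2 := by
    have h1 : 𝔮 ∈ (Ideal.span (({x, y} : Finset S₁) : Set S₁)).minimalPrimes := by
      rw [Finset.coe_insert, Finset.coe_singleton]; exact h𝔮min
    exact (Ideal.height_le_card_of_mem_minimalPrimes_span_finset h1).trans (by exact_mod_cast Finset.card_le_two)
  have hne : 𝔮 ≠ maximalIdeal S₁ := by
    intro e
    have hm : ((maximalIdeal S₁).height : WithBot ℕ∞) = (c : WithBot ℕ∞) := by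
      rw [IsLocalRing.maximalIdeal_height_eq_ringKrullDim, hdim]
    have hm' : (maximalIdeal S₁).height = c := by exact_mod_cast hm
    rw [e, hm'] at hht
    have : c ≤ 2 := by exact_mod_cast hht
    omega
  have hnotmax : ¬ 𝔮.IsMaximal := fun hM => hne (IsLocalRing.eq_maximalIdeal hM)
  have hf𝔮 : f₁ - h ^ p ∈ 𝔮 ^ 2 := by
    rw [he, pow_two]
    exact Ideal.mul_mem_mul (hI𝔮 (Ideal.subset_span (by simp))) (hI𝔮 (Ideal.subset_span (by simp)))
  exact sub_pow_not_mem_sq_of_isolated p f₁ hisol 𝔮 hnotmax h hf𝔮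

/-- **(B4) — no under-stripping.** In a regular local domain `S₁` of characteristic `p` and dimension `c ≥ 2`, if
`f₁ − h^p = x² · A` with `x ∈ 𝔪`, then the radicand ring `S₁[X]/(X^p − f₁)` violates the isolatedness binder: a minimal
prime `𝔮 ⊇ (x)` has height `≤ 1 < c`, is not maximal, and `f₁ − h^p ∈ 𝔮²` contradicts (B1). (In the chain: if a cleaner
of the previous member had order `≥ p·e + p`, the next member would be `x^p·A` plus a `p`-th power — so the stripping
exponent is never smaller than `⌊cleaned order / p⌋`.) [cite: Matsumura1987, Thm. 13.5 and Thm. 14.2] [folklore] -/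
theorem false_of_sub_pow_eq_sq_mul_of_isolated (c : ℕ) (hc : 2 ≤ c) (hdim : ringKrullDim S₁ = c) (f₁ h x A : S₁)
    (hx : x ∈ maximalIdeal S₁) (he : f₁ - h ^ p = x ^ 2 * A)
    (hisol : ∀ (Q : Ideal (AdjoinRoot ((X : S₁[X]) ^ p - C f₁))) [Q.IsPrime],
      (∃ Q' : Ideal (AdjoinRoot ((X : S₁[X]) ^ p - C f₁)), Q'.IsPrime ∧ Q < Q') →
      IsRegularLocalRing (Localization.AtPrime Q)) : False := by
  classical
  haveI : IsRegularRing S₁ := Literature.AlgebraicGeometry.Resolution.isRegularRing_of_isRegularLocalRing S₁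
  set I : Ideal S₁ := Ideal.span {x} with hI
  have hIm : I ≤ maximalIdeal S₁ := by
    rw [hI, Ideal.span_le, Set.singleton_subset_iff]
    exact hx
  obtain ⟨𝔮, h𝔮min, -⟩ := Ideal.exists_minimalPrimes_le hIm
  haveI h𝔮p : 𝔮.IsPrime := h𝔮min.1.1
  have hI𝔮 : I ≤ 𝔮 := h𝔮min.1.2
  have hht : 𝔮.height ≤ 1 := by
    have h1 : 𝔮 ∈ (Ideal.span (({x} : Finset S₁) : Set S₁)).minimalPrimes := by
      rw [Finset.coe_singleton]; exact h𝔮min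
    exact (Ideal.height_le_card_of_mem_minimalPrimes_span_finset h1).trans (by exact_mod_cast (Finset.card_singleton x).le)
  have hne : 𝔮 ≠ maximalIdeal S₁ := by
    intro e
    have hm : ((maximalIdeal S₁).height : WithBot ℕ∞) = (c : WithBot ℕ∞) := by
      rw [IsLocalRing.maximalIdeal_height_eq_ringKrullDim, hdim]
    have hm' : (maximalIdeal S₁).height = c := by exact_mod_cast hm
    rw [e, hm'] at hht
    have : c ≤ 1 := by exact_mod_cast hht
    omega
  have hnotmax : ¬ 𝔮.IsMaximal := fun hM => hne (IsLocalRing.eq_maximalIdeal hM)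
  have hx𝔮 : x ∈ 𝔮 := hI𝔮 (Ideal.subset_span (by simp))
  have hf𝔮 : f₁ - h ^ p ∈ 𝔮 ^ 2 := by
    rw [he]
    exact Ideal.mul_mem_right _ _ (Ideal.pow_mem_pow hx𝔮 2)
  exact sub_pow_not_mem_sq_of_isolated p f₁ hisol 𝔮 hnotmax h hf𝔮

end SingleMember

/-! ## The parity law for the chain: the binders of `NoEternalStrippedRadicandChain` -/

section Chain

open Literature.AlgebraicGeometry.Resolution

variable (p : ℕ) [hp : Fact p.Prime] {L : Type} [Field L] [CharP L p]

/-- **PARITY LAW (no cleaner beats the stripping exponent).** Under the binders of `NoEternalStrippedRadicandChain p c`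
with `c ≥ 3` (members `S m` regular local of dimension `c` inside a field of characteristic `p`, exceptional parameters
`x m` with `𝔪_m · S(m+1) = (x m)`, the STRIPPED law `f (m+1) · (x m)^(p · e m) = f m − (g m)^p`, multiplicity `p` after
cleaning and isolated radicand singularity at every member) and assuming `x m ∉ 𝔪_{m+1}²` (regular parameter; automatic for
a quadratic transform of a regular local ring, kept explicit as in (B2′)): for every stage `m` and EVERY `h ∈ S m`,
`f m − h^p ∉ 𝔪_m^(p · e m + 1)`. At `p = 2`: the cleaned order of every member is exactly `2 · e m` (even), odd cleaned
orders never occur past stage 0's successor, and `e m` is determined by the member. The quadratic-transform, excellence and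
`hinf` binders are not used. [cite: Matsumura1987, Thm. 13.5, Thm. 14.2 and Thm. 19.4] [cite: Cutkosky2014, §2.1] [folklore] -/
theorem cleaner_sub_pow_not_mem_pow_succ (S : ℕ → Subring L) [∀ m, IsLocalRing (S m)] (c : ℕ) (hc : 3 ≤ c)
    (hle : ∀ m, S m ≤ S (m + 1)) (f g : ∀ m, S m) (x : ∀ m, S (m + 1)) (e : ℕ → ℕ)
    (hreg : ∀ m, IsRegularLocalRing (S m)) (hdim : ∀ m, ringKrullDim (S m) = c)
    (hspan : ∀ m, Ideal.span ((fun y : S m => (⟨(y : L), hle m y.2⟩ : S (m + 1))) ''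
        (maximalIdeal (S m) : Set (S m))) = Ideal.span {x m})
    (hrel : ∀ m, ((f (m + 1) : S (m + 1)) : L) * ((x m : S (m + 1)) : L) ^ (p * e m) =
        ((f m : S m) : L) - ((g m : S m) : L) ^ p)
    (hxm : ∀ m, x m ∈ maximalIdeal (S (m + 1))) (hx2 : ∀ m, x m ∉ maximalIdeal (S (m + 1)) ^ 2)
    (hmult : ∀ m, ∃ h : S m, f m - h ^ p ∈ maximalIdeal (S m) ^ p)
    (hisol : ∀ m, ∀ (Q : Ideal (AdjoinRoot ((X : (S m)[X]) ^ p - C (f m)))) [Q.IsPrime],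
      (∃ Q' : Ideal (AdjoinRoot ((X : (S m)[X]) ^ p - C (f m))), Q'.IsPrime ∧ Q < Q') →
      IsRegularLocalRing (Localization.AtPrime Q))
    (m : ℕ) (h : S m) : f m - h ^ p ∉ maximalIdeal (S m) ^ (p * e m + 1) := by
  classical
  intro hord
  haveI := hreg (m + 1)
  haveI : IsDomain (S (m + 1)) := isDomain_of_isRegularLocalRing _
  haveI : IsIntegrallyClosed (S (m + 1)) := isIntegrallyClosed_of_isRegularLocalRing _
  have hp0 : p ≠ 0 := hp.out.ne_zero
  have hp2 : 2 ≤ p := hp.out.two_le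
  -- notation in `T := S (m+1)`
  let ι : S m →+* S (m + 1) := Subring.inclusion (hle m)
  have hι : ∀ y : S m, ι y = ⟨(y : L), hle m y.2⟩ := fun y => rfl
  have hιL : ∀ y : S m, ((ι y : S (m + 1)) : L) = (y : L) := fun y => rfl
  set X₀ : S (m + 1) := x m with hX₀
  set F₁ : S (m + 1) := f (m + 1) with hF₁
  have hx0 : X₀ ≠ 0 := fun e0 => hx2 m (by rw [← hX₀, e0]; exact Ideal.zero_mem _)
  -- `𝔪_m · T = (X₀)`, so `f m − h^p ∈ 𝔪_m^(pe+1)` becomes `ι(f m − h^p) = A · X₀^(pe+1)`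
  have hmap : (maximalIdeal (S m)).map ι = Ideal.span {X₀} := by
    rw [Ideal.map, ← hspan m]
    congr 1
  have hmem : ι (f m - h ^ p) ∈ Ideal.span {X₀ ^ (p * e m + 1)} := by
    have := Ideal.mem_map_of_mem ι hord
    rwa [Ideal.map_pow, hmap, Ideal.span_singleton_pow] at this
  obtain ⟨A, hA⟩ := Ideal.mem_span_singleton'.mp hmem
  -- the law in `T`: `F₁ · X₀^(pe) = ι (f m) − ι (g m)^p`
  have hlaw : F₁ * X₀ ^ (p * e m) = ι (f m) - ι (g m) ^ p := by
    apply Subtype.ext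
    have e0 : (((F₁ * X₀ ^ (p * e m) : S (m + 1))) : L) = (F₁ : L) * (X₀ : L) ^ (p * e m) := by push_cast; rfl
    have e0' : (((ι (f m) - ι (g m) ^ p : S (m + 1))) : L) = ((ι (f m) : S (m + 1)) : L) - ((ι (g m) : S (m + 1)) : L) ^ p := by
      push_cast; rfl
    rw [e0, e0', hιL, hιL, hF₁, hX₀]
    exact hrel m
  -- hence `(ι h − ι (g m))^p = X₀^(pe) · (F₁ − A · X₀)`
  have hHp : (ι h - ι (g m)) ^ p = (X₀ ^ e m) ^ p * (F₁ - A * X₀) := by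
    rw [sub_pow_char, ← pow_mul, mul_comm (e m) p]
    have e1 : ι h ^ p = ι (f m) - A * X₀ ^ (p * e m + 1) := by
      have := hA
      rw [map_sub, map_pow] at this
      -- this : A * X₀ ^ (p * e m + 1) = ι (f m) - ι h ^ p
      rw [this]; ring
    rw [e1]
    have e2 : ι (g m) ^ p = ι (f m) - F₁ * X₀ ^ (p * e m) := by rw [hlaw]; ring
    rw [e2]
    ring
  -- integrally closed: `X₀^e ∣ ι h − ι (g m)`
  have hdvd : X₀ ^ e m ∣ ι h - ι (g m) := by
    rw [← IsIntegrallyClosed.pow_dvd_pow_iff hp0, hHp]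
    exact Dvd.intro _ rfl
  obtain ⟨h', hh'⟩ := hdvd
  -- cancel `X₀^(pe)`: `h'^p = F₁ − A X₀`
  have hh'p : h' ^ p = F₁ - A * X₀ := by
    have e3 : (X₀ ^ e m) ^ p * h' ^ p = (X₀ ^ e m) ^ p * (F₁ - A * X₀) := by
      rw [← mul_pow, ← hh', hHp]
    exact mul_left_cancel₀ (pow_ne_zero _ (pow_ne_zero _ hx0)) e3
  have hF : F₁ - h' ^ p = X₀ * A := by rw [hh'p]; ring
  by_cases hAm : A ∈ maximalIdeal (S (m + 1))
  · -- `A ∈ 𝔪`: (B3)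
    exact false_of_sub_pow_eq_mul_of_isolated p c hc (hdim (m + 1)) F₁ h' X₀ A (hxm m) hAm hF (hisol (m + 1))
  · -- `A` a unit: contradiction with multiplicity `p` at stage `m+1` and `X₀ ∉ 𝔪²`
    obtain ⟨h'', hh''⟩ := hmult (m + 1)
    have e4 : F₁ - h'' ^ p = X₀ * A + (h' - h'') ^ p := by
      rw [sub_pow_char, ← hF]; ring
    rw [← hF₁] at hh''
    rw [e4] at hh''
    by_cases hd : h' - h'' ∈ maximalIdeal (S (m + 1))
    · have hdp : (h' - h'') ^ p ∈ maximalIdeal (S (m + 1)) ^ p := Ideal.pow_mem_pow hd p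
      have hXA : X₀ * A ∈ maximalIdeal (S (m + 1)) ^ p := by
        have := Ideal.sub_mem _ hh'' hdp
        rwa [add_sub_cancel_right] at this
      obtain ⟨u, rfl⟩ := IsLocalRing.notMem_maximalIdeal.mp hAm
      have hX : X₀ ∈ maximalIdeal (S (m + 1)) ^ p := by
        have e5 : X₀ = X₀ * ↑u * ↑u⁻¹ := by rw [Units.mul_inv_cancel_right]
        rw [e5]
        exact Ideal.mul_mem_right _ _ hXA
      exact hx2 m (Ideal.pow_le_pow_right hp2 hX)
    · have hunit : IsUnit ((h' - h'') ^ p) := (IsLocalRing.notMem_maximalIdeal.mp hd).pow p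
      have hXAm : X₀ * A ∈ maximalIdeal (S (m + 1)) := Ideal.mul_mem_right _ _ (hxm m)
      have hsum : X₀ * A + (h' - h'') ^ p ∈ maximalIdeal (S (m + 1)) :=
        Ideal.pow_le_self hp0 hh''
      have : (h' - h'') ^ p ∈ maximalIdeal (S (m + 1)) := by
        have := Ideal.sub_mem _ hsum hXAm
        rwa [add_sub_cancel_left] at this
      exact (IsLocalRing.notMem_maximalIdeal.mpr ((IsLocalRing.notMem_maximalIdeal.mp hd).pow p)) this

end Chain

end RadicandChain

end Summit.ResolutionOfSingularities.ResolutionOfSingularities.Theorems.SwitchingDichotomy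

end
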